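import Summits.HodgeConjecture.HodgeConjecture.Theorems.F0P6aSigmaGAL          -- («M-63» β layering) the Σ-GAL LEAF (A-p04 (g24) v3 44b59a9c): `ReadsCGalois` ∕ `ReadsCReading` (words of record, by import), `sigmaGAL_of_stub` SORRY-FREE; it imports the E-line DEFS module (D) `…Lines.F0_P6a_PELWitnessEDefs` (`AuxChartGS`, 60 fields incl. ED. 5 `junction`), ★ E6-R p847226 and the σ1∕D1∕D2 organs
import Summits.HodgeConjecture.HodgeConjecture.Theorems.F0P6aReadsCReadingOfJunction            -- ★ Σ-AN p848496 (A-p06 (g33)): `readsCReading_of_junction` (chart fields BY VALUE)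
import HarnessLib

/-!
# `F0P6aStubE6` — ★ RE-HOME (rung-0 re-homing task, books INVENTORY §8.4 M-3; LEAD F0P6-plan (g4) «M-72») of the crux workfile `Lines/F0_P6a_StubE6.lean`

This `Theorems/` module is the TREE BYTES of `Summits/HodgeConjecture/HodgeConjecture/Cruxes/HLiu418/Lines/F0_P6a_StubE6.lean` (edition of record,
tree sha16 13e64693fde2261b, 727 l., code-`sorry`-free) with the NAMESPACE KEPT — `Summit.HodgeConjecture.HodgeConjecture.Cruxes.HLiu418.F0P6aStubE6` — so that every
fully-qualified name (`StubE6`, `Reads`, `RingActionReading`, `RosatiOver`, `KottwitzOver`, `kottwitzOver_of_reading`, `exists_complexPoint_base_mem_connectedComponent`, `exists_flatPoint`, `exists_markedReading_of_reads`, `exists_ringActionReading_of_reads`, …; 22 declarations) is UNCHANGED; only this module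
docstring is re-headed and the `Lines` imports are switched to their ★ re-homed twins (`F0_P6a_SigmaGAL` → `Theorems.F0P6aSigmaGAL`).  Why a re-home: a `Theorems/` file cannot import a `Lines/` workfile (F0P6-ref1 o-6), and closing
stmt-HodgeConjecture-24832 `--as proved --by <Theorems decl>` at rung 0 needs the sorry-free Lines chain behind the gate (RE-HOME MAP v1.1, LA7-plan (g4),
2026-09-02; director g27 s1336 (R1)–(R3)).    Lines importers of the original: `F0_P6a_PELWitnessE`.
After this file is ★ the Lines workfile is meant to become a one-import SHIM of it (a `Lines/` write, batched per cone on the LEAD's word), so no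
environment ever holds two copies (NO-CROSS-IMPORT rule, «M-72» (3)).  It asserts nothing beyond what the workfile already proves.

## Original module docstring (verbatim)
# `stub_E6` CLOSER LEAF `Lines/F0_P6a_StubE6.lean` — ED. 1 candidate v2 (CLOSED), «M-63» β layering: l. 1 imports the Σ-GAL leaf (which imports the Defs module (D));
# = A-p06 (g33) E6 closer skeleton v8 5e42651e RE-TYPED over (D) with `hJ` := the ED. 5 FIELD `C.junction`, Σ-AN BY NAME (★ p848496) and Σ-GAL BY NAME
# (`F0P6aSigmaGAL.sigmaGAL_of_stub`, A-p04 (g24) v3) — NO socket left: `stub_E6_of_line : StubE6` SORRY-FREE, axioms TRIO (A-p06 (g34), GO500 SEATPLAN §1A row L6)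

Cell `hodgecm-mathlib`, crux hLiu418 (stmt-HodgeConjecture-24832), P6 «MOD», E-line `Lines/F0_P6a_PELWitnessE.lean` ED. 4 (2a1a8134) ∕ ED. 5 cand v6 (46d8c6a5),
socket `stub_E6` (:619 ∕ :777; its TYPE is byte-identical in both editions — `StubE6` below).  HONEST LABEL: HC_CM is proved only modulo the 7 printed citations
(2 remaining named inputs: hLiu418 = stmt-HodgeConjecture-24832, h413 = stmt-HodgeConjecture-24833) until rung 0 closes; this workfile is count-neutral and SORRY-FREE
with NO open input (v1's hypothesis `hGAL` is paid by the Σ-GAL leaf BY NAME).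

THE MATHEMATICS ([Kottwitz1992] §5; [Milne2005ShimuraVarieties] Prop. 13.1, Thm. 6.11; [Lange2023AbelianVarietiesComplex] §3.4).  For the CANONICAL pull-back
`P := C.𝓜.univ.baseChange (ε ≫ pr)` over `X := (S.M Kc) ⊗_F Fᵢ`:
* §0 SOCKETS BY VALUE — σ1 `Reads`∕`RingActionReading` (an `𝒪_F`-family READS `C.Mρ a b` through an ADMISSIBLE marking at every complex point), σR `RosatiOver`,
  σK `KottwitzOver`; Σ-ℂ `ReadsC` (the same over `X_ℂ`, Galois-equivariant), split into Σ-AN `ReadsCReading` and Σ-GAL `ReadsCGalois` — these two now live in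
  the Σ-GAL leaf (A-p06 (g33) closer v7's texts, byte-identical; imported here by `open …F0P6aSigmaGAL (ReadsCGalois ReadsCReading sigmaGAL_of_stub)`);
* §1 ORGANS, ALL PROVED — σK ⇐ σ1 (`kottwitzOver_of_reading`: ★ E6-K `charpoly_cotangentMap_eq_of_kottwitz`, faithful marking), D1 ⇐ σ1 (★ B-α
  `RingActionOfMarkedReadings`), D2 Σ-ℂ ⇒ σ1 (★ B-γ `ReadingComplexDescent` + `AbelianSchemeEndomorphismComplexDescent`), σR ⇐ σ1 BY NAME (★ E6-R
  `Theorems.F0P6aRosatiOverOfReading`, p847226), Σ-AN BY NAME (★ `Theorems.F0P6aReadsCReadingOfJunction.readsCReading_of_junction`, p848496, fed with the chart՚s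
  fields incl. the ED. 5 field `C.junction`);
* §1–§3 HEADS — `stub_E6_of` (σ1+σR+σK) → `stub_E6_of_reading_rosati` → `stub_E6_of_readsC_rosati` → `stub_E6_of_readsC` → `stub_E6_of_sigmaAN_sigmaGAL` →
  `stub_E6_of_sigmaGAL (hGAL) : StubE6` → **`stub_E6_of_line : StubE6 := stub_E6_of_sigmaGAL sigmaGAL_of_stub`** — every head SORRY-FREE; axioms TRIO.
WHAT CLOSED IT: Σ-GAL = the leaf `Lines/F0_P6a_SigmaGAL.lean` (A-p04 (g24) skeleton v3 44b59a9c: v2 0ee37645 + `stub_KCM` PAID by LA6-p01 (g0) cert v4 f1578ce1 over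
★ ONE-CALL `Theorems.F0P6aCMHomKernelShape` (LA6-p02) + ★ (REP) `UnitaryCurveSiegelChartMoverOfClass`; boxes LA6-r01 #6∕#10, LAref-E L6 #4 GREEN); the E-line ED. 6
pays its registered socket by `theorem stub_E6 : … := F0P6aStubE6.stub_E6_of_line` BY NAME (`import …Lines.F0_P6a_StubE6`; no cycle: Defs → Σ-GAL → StubE6 → E-line).
LINEAGE: v1 σK (A-p06 (g32)) → v3 σ1 organ layers → v4 D1 ★ → v5 D2 ★ → v5′ (A-p04 (g23): ED. 2 `_hU` binder, n3 heartbeat cure) → v6 σR by name + Σ split (g33) →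
v7 `Junction` by value → v8 Σ-AN by name → v9 (g34): over (D), `Junction` := field, `type_of% @stub_E6` := `StubE6` verbatim → v10 = THIS: + Σ-GAL by import, closed.

## References
* [Kottwitz1992] R. Kottwitz, *Points on some Shimura varieties over finite fields*, J. AMS 5 (1992), §5 pp. 389–391.
* [Milne2005ShimuraVarieties] J. S. Milne, *Introduction to Shimura Varieties* (2005; rev. 2017), §6 Thm. 6.11 p. 74, §13 Prop. 13.1 p. 117, §14 Prop. 14.12 p. 125.
* [Lange2023AbelianVarietiesComplex] H. Lange, *Abelian Varieties over the Complex Numbers* (2023), §3.4 Prop. 3.4.1.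
* [RapoportSmithlingZhang2020Diagonal] M. Rapoport, B. Smithling, W. Zhang, *Arithmetic diagonal cycles on unitary Shimura varieties* (2020), §4.1 p. 17.
* [MumfordFogartyKirwan1994] D. Mumford, J. Fogarty, F. Kirwan, *Geometric Invariant Theory* (3rd ed., 1994), Ch. 6 §1 Cor. 6.2 p. 116; App. to Ch. 7 §A pp. 234–235.
* [Shimura1963AnalyticFamilies] G. Shimura, *On analytic families of polarized abelian varieties and automorphic functions*, Ann. Math. 78 (1963), §2.
-/

set_option autoImplicit false

noncomputable section

namespace Summit.HodgeConjecture.HodgeConjecture.Cruxes.HLiu418.F0P6aStubE6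

set_option linter.dupNamespace false

open CategoryTheory CategoryTheory.Limits NumberField IsDedekindDomain MulAction Matrix AlgebraicGeometry
open scoped Matrix ComplexOrder Polynomial MonObj
open Literature.AlgebraicGeometry.Motives (SchemeOver AlgPoints ComplexPoints specOver)
open Literature.AlgebraicGeometry.Motives.AbelianVariety (bcSpec)
open Literature.AlgebraicGeometry.Motives.GaloisDescent (gal bc gal_fst)
open Literature.AlgebraicGeometry.AbelianSchemes (PolarizedAbelianSchemeWithLevel AbelianSchemeOver)
open Literature.AlgebraicGeometry.ModuliOfAbelianVarieties
open Literature.AlgebraicGeometry.ShimuraVarieties Literature.AlgebraicGeometry.ShimuraVarieties.UnitaryCanonicalModel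
open Literature.NumberTheory.Automorphic Literature.NumberTheory.Automorphic.UnitaryGroup
open Literature.NumberTheory.Automorphic.Liu2021.AppendixC (C5.OpenCompactSubgroup C5.SmallLevel)
open Literature.Geometry.Kaehler (ComplexTorus)
open Summit.HodgeConjecture.HodgeConjecture.Cruxes.HLiu418.F0P6aPELWitnessE (GSAdele IsCMTypeThrough mOf AuxChartGS)
open Summit.HodgeConjecture.HodgeConjecture.Cruxes.HLiu418.F0P6aSigmaGAL (ReadsCGalois ReadsCReading sigmaGAL_of_stub)

/-! ## §00 THE SOCKET'S STATEMENT, TOKEN FOR TOKEN (β layering: this leaf cannot import the E-line, so `type_of% @stub_E6` is not available here) -/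

/-- **`StubE6`** — the STATEMENT of the registered stub `F0P6aPELWitnessE.stub_E6` of the E-line `Lines/F0_P6a_PELWitnessE.lean` (ED. 4 2a1a8134 :619–:650 ≡
ED. 5 cand v6 46d8c6a5 :777–:808, byte-identical), copied TOKEN FOR TOKEN over the Defs module (D) (same namespace ⇒ every constant below is the E-line՚s own):
in every letter context, a polarized abelian scheme with level over `X := (S.M Kc) ⊗_F Fᵢ` related to `univ` along `ε ≫ pr`, with an `𝒪_F`-action satisfying the
ROSATI identities and the KOTTWITZ charpoly at every complex point.  The E-line ED. 6 pays its socket by `theorem stub_E6 : … := F0P6aStubE6.stub_E6_of_line`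
(SAME-STATEMENT: `StubE6` unfolds to the socket՚s type by `rfl`; tie `example : StubE6 = type_of% @F0P6aPELWitnessE.stub_E6 := rfl` is checked in the HOME cert
over the E-line, not here). (print: Kottwitz1992, §5 (pp. 389–391)) (print: RapoportSmithlingZhang2020Diagonal, §4.1 p. 17) -/
def StubE6 : Prop := ∀ (F : Type) [Field F] [NumberField F] [IsCMField F] [IsGalois ℚ F] (ι₁ : F →+* ℂ)
    (Jstar : Matrix (Fin 2) (Fin 2) F) (_hJ : (Jstar.map (IsCMField.complexConj F))ᵀ = Jstar) (_hJu : IsUnit Jstar)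
    (K₀ : C5.OpenCompactSubgroup (GSAdele F Jstar)) (S : RecordSystemGS F Jstar ι₁ K₀) (Kc : C5.SmallLevel K₀)
    (Fi : Type) [Field Fi] [NumberField Fi] [Algebra F Fi] [IsGalois F Fi] (τE : Fi →+* ℂ) (_hτE : τE.comp (algebraMap F Fi) = ι₁)
    (Φ : Set (F →+* ℂ)) (_hΦ : IsCMTypeThrough ι₁ Φ) (C : AuxChartGS F ι₁ Jstar K₀ S Kc Fi τE Φ)
    (ε : (Literature.AlgebraicGeometry.Motives.baseChange F Fi).obj (S.M.obj Kc) ⟶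
        (Literature.AlgebraicGeometry.Motives.baseChange ℚ Fi).obj C.𝓜.M)
    (_hε : letI : Algebra Fi ℂ := τE.toAlgebra
      ∀ (P : ComplexPoints ((Literature.AlgebraicGeometry.Motives.baseChange F Fi).obj (S.M.obj Kc)))
        (Pflat : letI : Algebra F ℂ := ι₁.toAlgebra; ComplexPoints (S.M.obj Kc)),
        Pflat.left = P.left ≫ pullback.fst (S.M.obj Kc).hom (bcSpec F Fi) →
        (AlgPoints.map ε P).left ≫ pullback.fst C.𝓜.M.hom (bcSpec ℚ Fi) =
          (letI : Algebra F ℂ := ι₁.toAlgebra; (C.f (S.pts Kc Pflat)).left))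
    (_hU : Literature.AlgebraicGeometry.ModuliOfAbelianVarieties.siegelUniversalFamilyUniformisation),
    ∃ (P : PolarizedAbelianSchemeWithLevel C.g C.N C.δ ((Literature.AlgebraicGeometry.Motives.baseChange F Fi).obj (S.M.obj Kc)).left)
      (G : P.A.X.left ⟶ C.𝓜.univ.A.X.left) (Ĝ : P.D.hat.X.left ⟶ C.𝓜.univ.D.hat.X.left)
      (_ : P.IsBaseChangeVia C.𝓜.univ (ε.left ≫ pullback.fst C.𝓜.M.hom (bcSpec ℚ Fi)) G Ĝ)
      (ρ : AbelianSchemeOver.RingAction (𝓞 F) P.A),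
      (∀ (b b' : 𝓞 F), (b' : F) = (IsCMField.complexConj F) (b : F) →
          haveI := ρ.isMonHom b
          ρ.i b' ≫ P.pol.lam = P.pol.lam ≫ AbelianSchemeOver.DualPair.dualIsogenyOver (ρ.i b) P.D P.D) ∧
      (letI : Algebra Fi ℂ := τE.toAlgebra
       ∀ (x : ComplexPoints ((Literature.AlgebraicGeometry.Motives.baseChange F Fi).obj (S.M.obj Kc))) (b : 𝓞 F),
        haveI := ρ.isMonHom b
        (Literature.AlgebraicGeometry.Motives.AbelianVariety.cotangentMap (P.A.fibre x.left).toAbelianVariety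
            (AbelianSchemeOver.fibreHom (ρ.i b) x.left)).charpoly =
          ∏ φ : F →+* ℂ, (Polynomial.X - Polynomial.C (φ (b : F))) ^ (mOf ι₁ Φ φ))

/-! ## §0 The sockets, by value -/

section Sockets

variable {F : Type} [Field F] [NumberField F] [IsCMField F] {ι₁ : F →+* ℂ} {Jstar : Matrix (Fin 2) (Fin 2) F}
  {K₀ : C5.OpenCompactSubgroup (GSAdele F Jstar)} {S : RecordSystemGS F Jstar ι₁ K₀} {Kc : C5.SmallLevel K₀}
  {Fi : Type} [Field Fi] [NumberField Fi] [Algebra F Fi] {τE : Fi →+* ℂ} {Φ : Set (F →+* ℂ)}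

/-- **`Reads C ε i hi`** — a family `i : 𝒪_F → End_X(P.A)` of homomorphisms of the CANONICAL pull-back `P := univ.baseChange (ε ≫ pr)` READS, at every complex point
`x` of `X` (along `τE`), for SOME representative `(v, a)` of that point (∃-REPRESENTATIVE form, ED. 2 of this socket: other representatives
`(v', a')` read through the unrelated frame `Mρ a'`) and every principal representative `r` of the piece `C.piece a`, through an
ADMISSIBLE marking `m` of the fibre `P.A_x` by `[J(C.Z a v), r]` (the three conjuncts of ★ `IsAdmissibleAt` at the point, `γ = 1`, `Ψ = Π_{C.Z a v}`),
as `intAct (C.Mρ a b)` on the model torus: `(i b)_x (m t) = m (ρ(Mρ a b) t)`.  OUTPUT of the analytic E6 organ (A-p06; P-3 chart + ★ U6-b + ★ E6-lin +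
GAGA ★ + ★ B-γ + ★ B-α). [cite: Lange2023AbelianVarietiesComplex, §3.4 Proposition 3.4.1] [cite: Kottwitz1992, §5 (p. 390)] -/
def Reads (C : AuxChartGS F ι₁ Jstar K₀ S Kc Fi τE Φ)
    (ε : (Literature.AlgebraicGeometry.Motives.baseChange F Fi).obj (S.M.obj Kc) ⟶
        (Literature.AlgebraicGeometry.Motives.baseChange ℚ Fi).obj C.𝓜.M)
    (i : 𝓞 F → ((C.𝓜.univ.baseChange (ε.left ≫ pullback.fst C.𝓜.M.hom (bcSpec ℚ Fi))).A.X ⟶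
      (C.𝓜.univ.baseChange (ε.left ≫ pullback.fst C.𝓜.M.hom (bcSpec ℚ Fi))).A.X))
    (hi : ∀ b, IsMonHom (i b)) : Prop :=
  letI P := C.𝓜.univ.baseChange (ε.left ≫ pullback.fst C.𝓜.M.hom (bcSpec ℚ Fi))
  letI : Algebra Fi ℂ := τE.toAlgebra
  ∀ (x : ComplexPoints ((Literature.AlgebraicGeometry.Motives.baseChange F Fi).obj (S.M.obj Kc)))
    (Pflat : letI : Algebra F ℂ := ι₁.toAlgebra; ComplexPoints (S.M.obj Kc)),
    Pflat.left = x.left ≫ pullback.fst (S.M.obj Kc).hom (bcSpec F Fi) →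
    ∃ (v : Fin 2 → ℂ) (hv : v ∈ negCone (Jstar.map ι₁)) (a : GSAdele F Jstar),
      (letI : Algebra F ℂ := ι₁.toAlgebra; S.pts Kc Pflat) = ShimuraSetGS.mk F Jstar ι₁ Kc.1.1 v hv a ∧
      ∀ (u : finAdeleQˣ) (r : gspFinAdelic C.δ),
        (∀ w, Valued.v ((u : finAdeleQ) w) = 1) →
        (u : finAdeleQ) - ((C.piece a : ZMod C.N).val : ℕ) ∈ levelIdeal C.N →
        r ∈ principalLevelSubgroup C.δ 1 →
        IsMultiplier (typeFormOver C.δ finAdeleQ) (r : GL (Fin C.g ⊕ Fin C.g) finAdeleQ) u →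
        ((r : GL (Fin C.g ⊕ Fin C.g) finAdeleQ) : Matrix (Fin C.g ⊕ Fin C.g) (Fin C.g ⊕ Fin C.g) finAdeleQ) =
          Matrix.fromBlocks 1 0 0 ((u : finAdeleQ) • (1 : Matrix (Fin C.g) (Fin C.g) finAdeleQ)) →
        ∃ (m : SiegelAdelicMarking ⟨SiegelModuli.jOfSiegel C.δ (C.Z a v),
              SiegelComplexRecordSystem.jOfSiegel_mem_C0pm C.hδ.1 (C.Z_mem a v hv)⟩ r (P.A.fibre x.left).toAbelianVariety)
          (Θ : Literature.AlgebraicGeometry.Motives.CartierDivisor (P.A.fibre x.left).toAbelianVariety.X.left)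
          (Λ : P.level.SymplecticLift x.left Θ C.δ),
          Θ.IsAmple ∧ P.A.IsLambdaOfAt x.left P.D P.pol.lam Θ ∧
          (∀ ⦃M : ℕ⦄, C.N ∣ M → M ≠ 0 → ∀ (y : Fin C.g ⊕ Fin C.g → ZMod M) (w : Fin C.g ⊕ Fin C.g → ℚ),
            AdelicCongr ((r⁻¹ : gspFinAdelic C.δ) : GL (Fin C.g ⊕ Fin C.g) finAdeleQ) 1 w (fun i => ((y i).val : ℚ) / M) →
              ((Λ.lift M (Multiplicative.ofAdd y)) : (P.A.fibre x.left).toAbelianVariety.Points ℂ) = m.r w) ∧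
          m.γ = 1 ∧ (∀ w : Fin C.g ⊕ Fin C.g → ℝ, m.Ψ w = siegelPeriodMap C.δ (C.Z a v) w) ∧
          ∀ (b : 𝓞 F) (t : ComplexTorus m.Ψ),
            haveI := hi b
            AlgPoints.map (AbelianSchemeOver.fibreHom (i b) x.left).hom.hom.hom (m.toFun t) =
              m.toFun (ComplexTorus.mapMatrix m.Ψ m.Ψ (C.Mρ a b) t)

/-- σ1 **`RingActionReading C ε ρ := Reads C ε ρ.i ρ.isMonHom`** — the `𝒪_F`-action `ρ` READS through admissible markings (see `Reads`).
[cite: Lange2023AbelianVarietiesComplex, §3.4 Proposition 3.4.1] [cite: Kottwitz1992, §5 (p. 390)] -/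
def RingActionReading (C : AuxChartGS F ι₁ Jstar K₀ S Kc Fi τE Φ)
    (ε : (Literature.AlgebraicGeometry.Motives.baseChange F Fi).obj (S.M.obj Kc) ⟶
        (Literature.AlgebraicGeometry.Motives.baseChange ℚ Fi).obj C.𝓜.M)
    (ρ : AbelianSchemeOver.RingAction (𝓞 F)
        (C.𝓜.univ.baseChange (ε.left ≫ pullback.fst C.𝓜.M.hom (bcSpec ℚ Fi))).A) : Prop :=
  Reads C ε ρ.i ρ.isMonHom

/-- σR **`RosatiOver C ε ρ`** — the Rosati identities over `X` for `ρ` (= the `stub_E6` clause verbatim; organ E6-R, A-p04 (g23): at one CM point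
per connected component from the CM structure, then over `X` by ★ B-α `eq_of_forall_exists_fieldPoint`). [cite: Kottwitz1992, §5 (p. 390)] -/
def RosatiOver (C : AuxChartGS F ι₁ Jstar K₀ S Kc Fi τE Φ)
    (ε : (Literature.AlgebraicGeometry.Motives.baseChange F Fi).obj (S.M.obj Kc) ⟶
        (Literature.AlgebraicGeometry.Motives.baseChange ℚ Fi).obj C.𝓜.M)
    (ρ : AbelianSchemeOver.RingAction (𝓞 F)
        (C.𝓜.univ.baseChange (ε.left ≫ pullback.fst C.𝓜.M.hom (bcSpec ℚ Fi))).A) : Prop :=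
  letI P := C.𝓜.univ.baseChange (ε.left ≫ pullback.fst C.𝓜.M.hom (bcSpec ℚ Fi))
  ∀ (b b' : 𝓞 F), (b' : F) = (IsCMField.complexConj F) (b : F) →
    haveI := ρ.isMonHom b
    ρ.i b' ≫ P.pol.lam = P.pol.lam ≫ AbelianSchemeOver.DualPair.dualIsogenyOver (ρ.i b) P.D P.D

/-- σK **`KottwitzOver C ε ρ`** — the Kottwitz clause of `stub_E6` verbatim (discharged from σ1 by ★ E6-K `charpoly_cotangentMap_eq_charpoly_analyticRep`
+ (F2) `C.Mρ_kottwitz` + a model transport `Fin C.g → ℂ ≃ Fin dim → ℂ`; A-p06, next iteration). [cite: Kottwitz1992, §5 (p. 390)] -/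
def KottwitzOver (C : AuxChartGS F ι₁ Jstar K₀ S Kc Fi τE Φ)
    (ε : (Literature.AlgebraicGeometry.Motives.baseChange F Fi).obj (S.M.obj Kc) ⟶
        (Literature.AlgebraicGeometry.Motives.baseChange ℚ Fi).obj C.𝓜.M)
    (ρ : AbelianSchemeOver.RingAction (𝓞 F)
        (C.𝓜.univ.baseChange (ε.left ≫ pullback.fst C.𝓜.M.hom (bcSpec ℚ Fi))).A) : Prop :=
  letI P := C.𝓜.univ.baseChange (ε.left ≫ pullback.fst C.𝓜.M.hom (bcSpec ℚ Fi))
  letI : Algebra Fi ℂ := τE.toAlgebra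
  ∀ (x : ComplexPoints ((Literature.AlgebraicGeometry.Motives.baseChange F Fi).obj (S.M.obj Kc))) (b : 𝓞 F),
    haveI := ρ.isMonHom b
    (Literature.AlgebraicGeometry.Motives.AbelianVariety.cotangentMap (P.A.fibre x.left).toAbelianVariety
        (AbelianSchemeOver.fibreHom (ρ.i b) x.left)).charpoly =
      ∏ φ : F →+* ℂ, (Polynomial.X - Polynomial.C (φ (b : F))) ^ (mOf ι₁ Φ φ)

end Sockets

/-! ## §0b σK from σ1: Kottwitz at complex points from the READING (★ E6-K any-model + (F2) `C.Mρ_kottwitz`) -/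

section SigmaK

variable {F : Type} [Field F] [NumberField F] [IsCMField F] {ι₁ : F →+* ℂ} {Jstar : Matrix (Fin 2) (Fin 2) F}
  {K₀ : C5.OpenCompactSubgroup (GSAdele F Jstar)} {S : RecordSystemGS F Jstar ι₁ K₀} {Kc : C5.SmallLevel K₀}
  {Fi : Type} [Field Fi] [NumberField Fi] [Algebra F Fi] {τE : Fi →+* ℂ} {Φ : Set (F →+* ℂ)}

/-- **σK ⇐ σ1.**  If the `𝒪_F`-action `ρ` on the canonical pull-back reads, at every complex point through an admissible marking `m` with
`Ψ = Π_{Z a v}`, as `intAct (Mρ a b)` (σ1), then the characteristic polynomial of `ρ(b)` on the cotangent space of every complex fibre is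
`∏_φ (X − φ b)^{m φ}` (σK): the flat point `Pflat` under `x` exists by the tower adjunction (★ `exists_unique_descend_of_tower`, `ι₁ = τE ∘ (F → Fᵢ)`),
the representative `[v, aKc]` READ by σ1, a principal representative `r` of the piece by ★ `exists_principalRep`; then ★ E6-K
`charpoly_cotangentMap_eq_charpoly_analyticRep_of_model` with `φ := m.toFun`, `A := Mρ a b`, `L := Cb` ((F2) `C.Mρ_kottwitz`: `Cb ∘ Π = Π ∘ Mρ a b`,
`charpoly Cb = ∏_φ (X − φ b)^{m φ}`). [cite: Kottwitz1992, §5 (p. 390)] [cite: LangeBirkenhake1992, §1.2 Prop. 1.2.1 (analytic and rational representations)] -/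
theorem kottwitzOver_of_reading (hτE : τE.comp (algebraMap F Fi) = ι₁) (C : AuxChartGS F ι₁ Jstar K₀ S Kc Fi τE Φ)
    (ε : (Literature.AlgebraicGeometry.Motives.baseChange F Fi).obj (S.M.obj Kc) ⟶
        (Literature.AlgebraicGeometry.Motives.baseChange ℚ Fi).obj C.𝓜.M)
    (ρ : AbelianSchemeOver.RingAction (𝓞 F)
        (C.𝓜.univ.baseChange (ε.left ≫ pullback.fst C.𝓜.M.hom (bcSpec ℚ Fi))).A)
    (hR : RingActionReading C ε ρ) : KottwitzOver C ε ρ := by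
  classical
  letI iFi : Algebra Fi ℂ := τE.toAlgebra
  letI iF : Algebra F ℂ := ι₁.toAlgebra
  intro x b
  haveI : IsScalarTower F Fi ℂ := IsScalarTower.of_algebraMap_eq' (by
    rw [RingHom.algebraMap_toAlgebra, RingHom.algebraMap_toAlgebra]
    exact hτE.symm)
  -- the flat point under `x` (tower adjunction `Hom_F(Spec ℂ, X₀) = Hom_{Fᵢ}(Spec ℂ, X₀ ⊗ Fᵢ)`)
  obtain ⟨Pflat, hP, -⟩ :=
    Literature.AlgebraicGeometry.Motives.exists_unique_descend_of_tower (K := F) (L := Fi) (S := ℂ)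
      (X := S.M.obj Kc) x
  have hPflat : Pflat.left = x.left ≫ pullback.fst (S.M.obj Kc).hom (bcSpec F Fi) := hP.symm
  -- the READ representative `[v, aKc]` of the Shimura point (σ1) and a principal representative `r` of its piece
  obtain ⟨v, hv, a, -, hR'⟩ := hR x Pflat hPflat
  have hN0 : C.N ≠ 0 := by have := C.hN; omega
  obtain ⟨u, r, hu₁, hu₂, hr₁, hr₂, hr₃⟩ := exists_principalRep C.δ hN0 (C.piece a)
  -- the admissible marking reading `ρ(b)` as `intAct (Mρ a b)`
  obtain ⟨m, Θ, Λ, -, -, -, -, hΨ, hread⟩ := hR' u r hu₁ hu₂ hr₁ hr₂ hr₃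
  -- the `ℂ`-linear avatar of `Mρ a b` and its characteristic polynomial (F2)
  obtain ⟨Cb, hCb, hchar⟩ := C.Mρ_kottwitz a v hv b
  rw [← hchar]
  haveI := ρ.isMonHom b
  have key := Literature.AlgebraicGeometry.HodgeTheory.charpoly_cotangentMap_eq_charpoly_analyticRep_of_model
    m.isAnalytification m.toFun_add (AbelianSchemeOver.fibreHom (ρ.i b) x.left) (C.Mρ a b) (LinearMap.toContinuousLinearMap Cb)
    (fun w => by rw [LinearMap.coe_toContinuousLinearMap', hΨ, hΨ, hCb]) (fun t => (hread b t).symm)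
  rw [key, LinearMap.coe_toContinuousLinearMap]

end SigmaK


/-! (★ re-home, size lint: this is PART A of `Lines/…` — the file continues, in the same namespace, in `Theorems.F0P6aStubE6Organ.lean`.) -/

end Summit.HodgeConjecture.HodgeConjecture.Cruxes.HLiu418.F0P6aStubE6

end
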